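import Literature.MathematicalPhysics.QuantumFieldTheory.ConformalBootstrap3D.PointKernelK34L515.Cert

/-!
# K34L515 instance, cell `l2c0` (parts file: groups 1:12,1:24)

Kernel-v3 cell of the point-functional exclusion instance for the lower box `Δσ ∈ [0.515, 0.520]`,
`Δε ∈ [0.6, 0.95)` (certificate `certL515`, module `PointKernelK34L515.Cert`): spin `ℓ = 2`,
`Δ ∈ [3, 97/32)` (centre `A`, half-width `2^-6`), Taylor degree `3`, `n_F = 40`, `2` s-piece(s)
covering `s = Δσ ∈ [103/200, 13/25]`.  Group theorems `l2c0_part<i>_<a>_<b> : gPart … = some <literal>` are checked by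
`decide +kernel` (the literals were produced by `#eval` of the same function); the cell numbers `l2c0_num<i> ≥ 0`
likewise; `l2c0_block` is `PKTM.blockPositive_of_cellPass` applied to them. This file holds only group theorems (the cell stated as a literal); the final file of the cell imports it.  Generated by
`gen/mk_v3cell.py` / `gen/drive_v3.py` (typer-g8).  [folklore]
-/

set_option Elab.async false

namespace Literature.MathematicalPhysics.QuantumFieldTheory.ConformalBootstrap3D

namespace PointKernelK34L515

open PointKernel PKTM
open Literature.Analysis.ValidatedNumerics.PolyMP
open Literature.Analysis.ValidatedNumerics.NumericsMP

/-- group model literal [folklore] -/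
def l2c0_g1_12_24 : G3 := ([⟨-1607416659531701146095870029754530645, -1607414694289629806446543514777578993⟩, ⟨-6182499649090967061716454617587564274, -6182497571780861317035325247992451935⟩, ⟨-3363505098022522537439608455199764408, -3363502336215276876542709159940457021⟩, ⟨839217809357347923351408955483630442, 839220822794905192121903235818836707⟩], [⟨-11404917647233434183966006070521805, -11404908632297797171279494726569419⟩, ⟨58933625105259403870387045122781709, 58933634998594116911598591262379962⟩, ⟨7452437380990221954184813729530650, 7452450631698693453257376160551931⟩, ⟨-2948443885478913841296488257984159, -2948429331356102940356265728357706⟩], [⟨130824556194443995669382371847330, 130824577526814401080050692773026⟩, ⟨-214390817029191321692796813141648, -214390793089104633119033900286618⟩, ⟨6440207977549311139668159946087, 6440240219458626617972657480637⟩, ⟨3594478809148544283929208465049, 3594514398490125941934798059613⟩])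

/-- group model literal [folklore] -/
def l2c0_g1_24_34 : G3 := ([⟨-188302124294511381909854430182999271189, -188302122234290975678925726845885312677⟩, ⟨-31112839323530150399588186591210388225, -31112837139059827860185587654369898028⟩, ⟨15716756609671662665498583943123473216, 15716759737672601908830181491206840367⟩, ⟨-6716693744127672631928181691366541110, -6716690077322123620091317830779478198⟩], [⟨1100415354502712786892244522881078104, 1100415364985768696446460113264428070⟩, ⟨73624868725300557967471597343058908, 73624880856597520009639684997406863⟩, ⟨-47623933113254433557189054525997411, -47623915666307252318341279355764181⟩, ⟨26078701946601967844362561991835136, 26078722473892885954855052338989317⟩], [⟨-2900637461438073115729566541984276, -2900637433371083367670716124076661⟩, ⟨-75268837643038532598544563785220, -75268803766880422581564337944663⟩, ⟨82759565143736639201374558447488, 82759614009470498643851694545711⟩, ⟨-55849851936840007536846404065590, -55849794296427748897197532339568⟩])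

/-- group `[12, 24)` of piece 1 [folklore] -/
theorem l2c0_part1_12_24 : gPart certL515 (⟨2, ((193 : ℚ) / 64), 6, 3, 40, 6, 64, ⟨1, 0, 5, 65, 0, 0⟩⟩ : TMCell) (pc ps2 1) 12 24 = some l2c0_g1_12_24 := by decide +kernel

/-- group `[24, 34)` of piece 1 [folklore] -/
theorem l2c0_part1_24_34 : gPart certL515 (⟨2, ((193 : ℚ) / 64), 6, 3, 40, 6, 64, ⟨1, 0, 5, 65, 0, 0⟩⟩ : TMCell) (pc ps2 1) 24 34 = some l2c0_g1_24_34 := by decide +kernel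

end PointKernelK34L515

end Literature.MathematicalPhysics.QuantumFieldTheory.ConformalBootstrap3D
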